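import Summits.NavierStokesRegularity.FluidComputer.RotorKnobDouse
import HarnessLib

/-!
# The seed–rotor scale knob under the PULSE hypothesis, part 1: the clock survives the pulse

Cell `pub-fluidc`, blueprint seat bp1 (gen 24); ONE text split by the 400-line rule into
`RotorKnobPulse{Fire,Douse,Beable}.lean` + `RotorKnobPulse.lean`; namespace
`Summit.NavierStokesRegularity.FluidComputer.RotorKnob` (parts 7–10 of the `RotorKnob*` chain).
HONEST FRAMING (verbatim): low prior, high value-of-information experiment on Tao's machine
paradigm; NOT a claim that NS blows up. Everything concerns the five-mode truncation (5.5) of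
[Tao2016AveragedNS, §5.5] in the two-scale form `rotorCircuit K M ε ρ` (clock/amplifier scale `ε`:
`∂ₜb = εa² - ε⁻¹Mc²`, amplifier `ε⁻¹M : b ⇒ c`; seed/rotor scale `ρ`: seed `ρ²e^{-M} : a → c`,
rotor `ρ⁻²c : a ⇒ d`; the diagonal `ρ = ε` is `delayCircuitWith K M ε`, and `M = K¹⁰`, `ρ = ε` is
Tao's circuit) started EXACTLY at (5.6) `delayInit`; nothing is proved about Navier–Stokes.

WHAT THE CHAIN PROVES. `RotorKnobTransition.lean` (gen 22) certifies Theorem 5.3 for the knob family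
with a POLYNOMIAL clock `ε ≤ K⁻¹⁰⁰` under the seed–rotor condition `ρ⁴ ≤ ε²e^{-18M}/(64M)`
(`RotorKnob.transition_explicit`). The exponential enters at ONE place, `RotorKnob.b_lower_after`:
the clock `b` must not be doused (`∂ₜb ≥ -ε⁻¹Mc² ≥ -ε/16`) on the whole window `[t_c, 2]`, where
`c` is only bounded by the crude Grönwall `c ≤ 2ρ²e^{(5t-1)M}`. As on the diagonal
(`AmplitudeKnob*.lean`, gen 20) the transfer is COMPLETE at the delivery time
`T₀ = t_c + 880 log K/M + 1/K + 300 log K/K`, after which `ã` is monotone and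
`a² + b² + c² + d² = 1 - ã²` only decreases; so it suffices that the trigger PULSE
`c ≤ 2K⁻¹⁰ρ²e^{2M(t-t_c)}` (`c_pulse_le`) does not douse the clock before `T₀`, which is the
PULSE HYPOTHESIS `(hρT) 64·M·ρ⁴·e^{4M(T-t_c)} ≤ ε²K²⁰` of every lemma below (horizon `T ≤ 2`).
Part 4 discharges it from `ρ² ≤ ε·e^{-700·M·log K/K}/K¹⁸⁰⁰` with the clock polynomial: the knob
`σ = ρ²/ε` need only be `e^{-Θ(M log K/K)}`-small (gen 22: `e^{-9M}/(8√M)`), and a FIXED POWER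
`σ ≤ K⁻¹⁸⁰¹` suffices for every amplifier `M ≤ K/(700 log K)`.

THIS FILE (§PhaseTwo on the horizon `T`): `b_le_linear` (`b ≤ εt`), `c_pulse_le`, `b_lower_on`
(`b ≥ ε/8` on `[t_c, T]`), `c_growth_on`, `c_large_on` ((c-large) `c ≥ K¹⁰⁰ρ²` on `[t_c + δ, T]`
when `K¹¹⁰ ≤ e^{Mδ/8}`), `c_deriv_bounds_on` ((cgrow-2)). The quiet phase `[0, t_c]` is
`RotorKnob{,Trigger,Critical}.lean` reused BY NAME (it never used the exponential hypothesis; it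
uses `ρ² ≤ ε` and `Mρ⁴ ≤ ε²`, both implied by (hρT) at `T = T₀`, part 4).
[cite: Tao2016AveragedNS, §5.5 Thm 5.3 proof: (bogo-2), (c-large), (cgrow-2)]. No named facts;
0 sorry.
-/

noncomputable section

namespace Summit.NavierStokesRegularity.FluidComputer.RotorKnob

open Set Real Filter
open _root_.Topology
open Literature.Analysis.FluidPDE.Tao2016AveragedNS
open Literature.Analysis.FluidPDE.Tao2016AveragedNS.Thm53 (antitoneOn_intFactor monotoneOn_intFactor
  antitoneOn_sub_of_deriv_le monotoneOn_sub_of_le_deriv init_b)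

section PulseFire

variable {K M ε ρ τ δ T : ℝ} {X : ℝ → Fin 5 → ℝ}


/-! ## The trigger pulse and the clock on `[t_c, T]` -/

/-- The clock never runs ahead of `εt`: `b(t) ≤ εt` for `t ≥ 0` (`∂ₜb = εa² - ε⁻¹Mc² ≤ ε`).
[cite: Tao2016AveragedNS, §5.5 (b-eq)] -/
theorem b_le_linear (hX : ∀ t, HasDerivAt X (rotorCircuit K M ε ρ (X t)) t) (h0 : X 0 = delayInit)
    (hε : 0 ≤ ε) (hM0 : 0 ≤ M) {t : ℝ} (ht : 0 ≤ t) : X t 1 ≤ ε * t := by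
  have hanti := antitoneOn_sub_of_deriv_le (s := Ici (0 : ℝ)) (φ := fun _ => ε)
    (Φ := fun s => ε * s) (convex_Ici 0) (fun s _ => hasDerivAt_b hX s)
    (fun s _ => ((hasDerivAt_id s).const_mul ε).congr_deriv (by simp))
    (fun s _ => by
      have ha : X s 0 ^ 2 ≤ 1 := traj_sq_le_one hX h0 s 0
      have h1 : ε * X s 0 ^ 2 ≤ ε := by nlinarith
      have h2 : 0 ≤ ε⁻¹ * M * X s 2 ^ 2 := by positivity
      linarith)
  have h := hanti (mem_Ici.2 le_rfl) (mem_Ici.2 ht) ht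
  simp only [init_b h0, mul_zero, sub_zero] at h
  linarith

/-- **The trigger pulse.** After the critical time the trigger is at most
`c(t) ≤ 2K⁻¹⁰ρ²·e^{2M(t - t_c)}` (`t ∈ [t_c, 2]`, `t - t_c ≤ 1`): from `∂ₜc = ρ²e^{-M}a² + ε⁻¹Mbc ≤
ρ²e^{-M} + 2Mc` (`b ≤ 2ε`, `c ≥ 0`), `c(t_c) = K⁻¹⁰ρ²` and `ρ²e^{-M} ≤ K⁻¹⁰ρ²`. This replaces the
crude bound (code) `c ≤ 2ρ²e^{(5t-1)M}` of `RotorKnobTrigger.lean`, which is what forces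
`ρ⁴ ≤ ε²e^{-Θ(M)}` in gen 22's `RotorKnob.b_lower_after`.
[cite: Tao2016AveragedNS, §5.5 (code), (c-eq)] -/
theorem c_pulse_le (hX : ∀ t, HasDerivAt X (rotorCircuit K M ε ρ (X t)) t) (h0 : X 0 = delayInit)
    (hε : 0 < ε) (hM0 : 0 ≤ M) (hKM : exp (-M) ≤ 1 / K ^ 10) (hτ0 : 0 ≤ τ)
    (hcτeq : X τ 2 = ρ ^ 2 / K ^ 10) {t : ℝ} (ht : t ∈ Icc τ 2) (htτ : t - τ ≤ 1) :
    X t 2 ≤ 2 * (ρ ^ 2 / K ^ 10) * exp (2 * M * (t - τ)) := by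
  set μ : ℝ := ρ ^ 2 * exp (-M) with hμ
  have hμ0 : 0 ≤ μ := by positivity
  have hanti := antitoneOn_intFactor (s := Icc τ 2) (g := fun _ => 2 * M)
    (G := fun s => 2 * M * (s - τ)) (φ := fun _ => μ) (Φ := fun s => μ * s) (convex_Icc τ 2)
    (fun s _ => hasDerivAt_c hX s)
    (fun s _ => (((hasDerivAt_id s).sub_const τ).const_mul (2 * M)).congr_deriv (by simp))
    (fun s _ => ((hasDerivAt_id s).const_mul μ).congr_deriv (by simp))
    (fun s hs => by
      have hs0 : 0 ≤ s := hτ0.trans hs.1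
      have hc0 : 0 ≤ X s 2 := c_nonneg hX h0 hs0
      have hb : X s 1 ≤ 2 * ε :=
        (b_le_linear hX h0 hε.le hM0 hs0).trans (by nlinarith [hs.2, hε.le])
      have ha : X s 0 ^ 2 ≤ 1 := traj_sq_le_one hX h0 s 0
      have hexp1 : exp (-(2 * M * (s - τ))) ≤ 1 := by
        rw [exp_le_one_iff, neg_nonpos]
        have : 0 ≤ s - τ := by linarith [hs.1]
        positivity
      have h1 : ρ ^ 2 * exp (-M) * X s 0 ^ 2 ≤ μ := by
        simpa [hμ] using mul_le_mul_of_nonneg_left ha (by positivity : 0 ≤ ρ ^ 2 * exp (-M))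
      have h2 : ε⁻¹ * M * X s 1 * X s 2 ≤ 2 * M * X s 2 := by
        have h5 : ε⁻¹ * X s 1 ≤ 2 := by rw [inv_mul_le_iff₀ hε]; linarith
        have : ε⁻¹ * M * X s 1 * X s 2 = (ε⁻¹ * X s 1) * (M * X s 2) := by ring
        rw [this]
        nlinarith [mul_nonneg hM0 hc0]
      have hbr : ρ ^ 2 * exp (-M) * X s 0 ^ 2 + ε⁻¹ * M * X s 1 * X s 2 - 2 * M * X s 2 ≤ μ := by
        linarith
      calc (ρ ^ 2 * exp (-M) * X s 0 ^ 2 + ε⁻¹ * M * X s 1 * X s 2 - 2 * M * X s 2)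
            * exp (-(2 * M * (s - τ)))
          ≤ μ * exp (-(2 * M * (s - τ))) := mul_le_mul_of_nonneg_right hbr (exp_pos _).le
        _ ≤ μ * 1 := mul_le_mul_of_nonneg_left hexp1 hμ0
        _ = μ := mul_one _)
  have hτ2 : τ ≤ 2 := ht.1.trans ht.2
  have hτmem : τ ∈ Icc τ 2 := ⟨le_rfl, hτ2⟩
  have h := hanti hτmem ht ht.1
  simp only [sub_self, mul_zero, neg_zero, exp_zero, mul_one, hcτeq] at h
  have hμle : μ * t - μ * τ ≤ ρ ^ 2 / K ^ 10 := by
    rw [← mul_sub]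
    calc μ * (t - τ) ≤ μ * 1 := mul_le_mul_of_nonneg_left htτ hμ0
      _ = ρ ^ 2 * exp (-M) := by simp [hμ]
      _ ≤ ρ ^ 2 * (1 / K ^ 10) := mul_le_mul_of_nonneg_left hKM (by positivity)
      _ = ρ ^ 2 / K ^ 10 := by ring
  have h' : X t 2 * exp (-(2 * M * (t - τ))) ≤ 2 * (ρ ^ 2 / K ^ 10) := by linarith
  have hE : X t 2 = X t 2 * exp (-(2 * M * (t - τ))) * exp (2 * M * (t - τ)) := by
    rw [mul_assoc, ← exp_add, neg_add_cancel, exp_zero, mul_one]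
  rw [hE]
  exact mul_le_mul_of_nonneg_right h' (exp_pos _).le

/-- **The clock survives the pulse**: `b ≥ ε/8` on `[t_c, T]` for any horizon `T ≤ 2` with
(hρT) `64·M·ρ⁴·e^{4M(T-t_c)} ≤ ε²K²⁰` — from (bogo-2) `b(t_c) ≥ ε/2` and `∂ₜb ≥ -ε⁻¹Mc² ≥
-4Mε⁻¹ρ⁴K⁻²⁰e^{4M(T-t_c)} ≥ -ε/16` by `c_pulse_le`. Gen 22's `RotorKnob.b_lower_after` is the
same with `T = 2` and `ρ⁴ ≤ ε²e^{-18M}/(64M)`.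
[cite: Tao2016AveragedNS, §5.5 proof ("`b ≳ ε` on `[t_c,2]`")] -/
theorem b_lower_on (hX : ∀ t, HasDerivAt X (rotorCircuit K M ε ρ (X t)) t) (h0 : X 0 = delayInit)
    (hε : 0 < ε) (hρ : 0 < ρ) (hρε : ρ ^ 2 ≤ ε) (hM0 : 0 < M) (hK : 16 ≤ K)
    (hεK : ε ^ 2 ≤ 1 / (6 * K ^ 20)) (hMρ : M * ρ ^ 4 ≤ ε ^ 2) (hKM : exp (-M) ≤ 1 / K ^ 10)
    (hτ1 : 1 ≤ τ) (hτT : τ ≤ T) (hT2 : T ≤ 2)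
    (hρT : 64 * M * ρ ^ 4 * exp (4 * M * (T - τ)) ≤ ε ^ 2 * K ^ 20)
    (hcτ : ∀ t, 0 ≤ t → t ≤ τ → X t 2 ≤ ρ ^ 2 / K ^ 10) (hcτeq : X τ 2 = ρ ^ 2 / K ^ 10)
    {t : ℝ} (ht : t ∈ Icc τ T) : ε / 8 ≤ X t 1 := by
  have hK0 : 0 < K := by linarith
  have hK1 : 1 ≤ K := by linarith
  have hε0 : ε ≠ 0 := hε.ne'
  have hτ2 : τ ≤ 2 := hτT.trans hT2
  -- `b(τ) ≥ ε/2` by (bogo-2)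
  have hbτ : ε / 2 ≤ X τ 1 := by
    have hb := b_linear hX h0 hε hρ hρε hM0 hK1 hτ2 hεK hMρ hcτ (t := τ) ⟨by linarith, le_rfl⟩
    have h1 := (abs_le.1 hb).1
    have hK20 : 34 / K ^ 20 ≤ 1 / 2 := by
      rw [div_le_div_iff₀ (by positivity) (by norm_num)]
      have : (2 : ℝ) ^ 20 ≤ K ^ 20 := pow_le_pow_left₀ (by norm_num) (by linarith) 20
      nlinarith
    have h2 : 17 * ε / K ^ 20 * τ ≤ 34 / K ^ 20 * ε := by
      have : 17 * ε / K ^ 20 * τ ≤ 17 * ε / K ^ 20 * 2 :=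
        mul_le_mul_of_nonneg_left hτ2 (by positivity)
      have h2e : 17 * ε / K ^ 20 * 2 = 34 / K ^ 20 * ε := by ring
      linarith
    have h3 : 34 / K ^ 20 * ε ≤ 1 / 2 * ε := mul_le_mul_of_nonneg_right hK20 hε.le
    nlinarith
  -- `∂ₜb ≥ -ε/16` on `[τ,T]`: the pulse cannot douse the clock before `T`
  have hmono := monotoneOn_sub_of_le_deriv (φ := fun _ => -(ε / 16))
    (Φ := fun s => -(ε / 16) * s) (convex_Icc τ T) (fun s _ => hasDerivAt_b hX s)
    (fun s _ => ((hasDerivAt_id s).const_mul (-(ε / 16))).congr_deriv (by simp))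
    (fun s hs => by
      have hs2 : s ∈ Icc τ 2 := ⟨hs.1, hs.2.trans hT2⟩
      have hc0 : 0 ≤ X s 2 := c_nonneg hX h0 (by linarith [hs.1])
      have hcp := c_pulse_le hX h0 hε hM0.le hKM (by linarith) hcτeq hs2 (by linarith [hs.2])
      have hcT : X s 2 ≤ 2 * (ρ ^ 2 / K ^ 10) * exp (2 * M * (T - τ)) := by
        refine hcp.trans (mul_le_mul_of_nonneg_left (exp_le_exp.2 ?_) (by positivity))
        have : s - τ ≤ T - τ := by linarith [hs.2]
        nlinarith [hM0.le]
      have hc2 : X s 2 ^ 2 ≤ (2 * (ρ ^ 2 / K ^ 10) * exp (2 * M * (T - τ))) ^ 2 :=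
        pow_le_pow_left₀ hc0 hcT 2
      have hνc : ε⁻¹ * M * X s 2 ^ 2 ≤ ε / 16 := by
        have hsq : (2 * (ρ ^ 2 / K ^ 10) * exp (2 * M * (T - τ))) ^ 2
            = 4 * ρ ^ 4 * exp (4 * M * (T - τ)) / K ^ 20 := by
          rw [show (4 : ℝ) * M * (T - τ) = 2 * M * (T - τ) + 2 * M * (T - τ) by ring, exp_add]
          field_simp
          ring
        calc ε⁻¹ * M * X s 2 ^ 2
            ≤ ε⁻¹ * M * (2 * (ρ ^ 2 / K ^ 10) * exp (2 * M * (T - τ))) ^ 2 :=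
              mul_le_mul_of_nonneg_left hc2 (by positivity)
          _ = ε / 16 * (64 * M * ρ ^ 4 * exp (4 * M * (T - τ)) / (ε ^ 2 * K ^ 20)) := by
              rw [hsq]
              field_simp
              ring
          _ ≤ ε / 16 * 1 := by
              refine mul_le_mul_of_nonneg_left ?_ (by positivity)
              rwa [div_le_one (by positivity)]
          _ = ε / 16 := mul_one _
      have ha2 : 0 ≤ ε * X s 0 ^ 2 := by positivity
      linarith)
  have hτmem : τ ∈ Icc τ T := ⟨le_rfl, hτT⟩
  have h := hmono hτmem ht ht.1
  simp only at h
  have : t - τ ≤ 1 := by linarith [ht.2]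
  nlinarith

/-! ## (c-large) and (cgrow-2) on the horizon `T` -/

/-- Exponential growth after `t_c`: `c(t) ≥ K⁻¹⁰ρ²·e^{M(t-t_c)/8}` on `[t_c, T]`
(`∂ₜc ≥ ε⁻¹Mbc ≥ (M/8)c` by `b_lower_on`). [cite: Tao2016AveragedNS, §5.5 (c-large)] -/
theorem c_growth_on (hX : ∀ t, HasDerivAt X (rotorCircuit K M ε ρ (X t)) t) (h0 : X 0 = delayInit)
    (hε : 0 < ε) (hρ : 0 < ρ) (hρε : ρ ^ 2 ≤ ε) (hM0 : 0 < M) (hK : 16 ≤ K)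
    (hεK : ε ^ 2 ≤ 1 / (6 * K ^ 20)) (hMρ : M * ρ ^ 4 ≤ ε ^ 2) (hKM : exp (-M) ≤ 1 / K ^ 10)
    (hτ1 : 1 ≤ τ) (hτT : τ ≤ T) (hT2 : T ≤ 2)
    (hρT : 64 * M * ρ ^ 4 * exp (4 * M * (T - τ)) ≤ ε ^ 2 * K ^ 20)
    (hcτ : ∀ t, 0 ≤ t → t ≤ τ → X t 2 ≤ ρ ^ 2 / K ^ 10) (hcτeq : X τ 2 = ρ ^ 2 / K ^ 10)
    {t : ℝ} (ht : t ∈ Icc τ T) :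
    ρ ^ 2 / K ^ 10 * exp (M * (t - τ) / 8) ≤ X t 2 := by
  have hK0 : 0 < K := by linarith
  have hε0 : ε ≠ 0 := hε.ne'
  have hmono := monotoneOn_intFactor (s := Icc τ T) (g := fun _ => M / 8)
    (G := fun s => M / 8 * s) (φ := fun _ => 0) (Φ := fun _ => 0) (convex_Icc τ T)
    (fun s _ => hasDerivAt_c hX s)
    (fun s _ => ((hasDerivAt_id s).const_mul (M / 8)).congr_deriv (by simp))
    (fun s _ => hasDerivAt_const s (0 : ℝ))
    (fun s hs => by
      have hc0 : 0 ≤ X s 2 := c_nonneg hX h0 (by linarith [hs.1])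
      have hb : ε / 8 ≤ X s 1 :=
        b_lower_on hX h0 hε hρ hρε hM0 hK hεK hMρ hKM hτ1 hτT hT2 hρT hcτ hcτeq hs
      have hνb : M / 8 ≤ ε⁻¹ * M * X s 1 := by
        calc M / 8 = ε⁻¹ * M * (ε / 8) := by field_simp
          _ ≤ ε⁻¹ * M * X s 1 := mul_le_mul_of_nonneg_left hb (by positivity)
      have h1 : M / 8 * X s 2 ≤ ε⁻¹ * M * X s 1 * X s 2 := mul_le_mul_of_nonneg_right hνb hc0
      have h2 : 0 ≤ ρ ^ 2 * exp (-M) * X s 0 ^ 2 := by positivity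
      have : 0 ≤ ρ ^ 2 * exp (-M) * X s 0 ^ 2 + ε⁻¹ * M * X s 1 * X s 2 - M / 8 * X s 2 := by
        linarith
      exact mul_nonneg this (exp_pos _).le)
  have hτmem : τ ∈ Icc τ T := ⟨le_rfl, hτT⟩
  have h := hmono hτmem ht ht.1
  simp only [sub_zero, hcτeq] at h
  have hE : X t 2 = X t 2 * exp (-(M / 8 * t)) * exp (M / 8 * t) := by
    rw [mul_assoc, ← exp_add, neg_add_cancel, exp_zero, mul_one]
  rw [hE]
  calc ρ ^ 2 / K ^ 10 * exp (M * (t - τ) / 8)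
      = ρ ^ 2 / K ^ 10 * exp (-(M / 8 * τ)) * exp (M / 8 * t) := by
        rw [mul_assoc, ← exp_add]; congr 2; ring
    _ ≤ X t 2 * exp (-(M / 8 * t)) * exp (M / 8 * t) :=
        mul_le_mul_of_nonneg_right h (exp_pos _).le

/-- **(c-large) on the horizon `T`**: `c ≥ K¹⁰⁰ρ²` on `I = [t_c + δ, T]` for any onset delay `δ ≥ 0`
with `e^{Mδ/8} ≥ K¹¹⁰` (for the family `δ = 880 log K/M` exactly).
[cite: Tao2016AveragedNS, §5.5 (c-large)] -/
theorem c_large_on (hX : ∀ t, HasDerivAt X (rotorCircuit K M ε ρ (X t)) t) (h0 : X 0 = delayInit)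
    (hε : 0 < ε) (hρ : 0 < ρ) (hρε : ρ ^ 2 ≤ ε) (hM0 : 0 < M) (hK : 16 ≤ K)
    (hεK : ε ^ 2 ≤ 1 / (6 * K ^ 20)) (hMρ : M * ρ ^ 4 ≤ ε ^ 2) (hKM : exp (-M) ≤ 1 / K ^ 10)
    (hδ : 0 ≤ δ) (hon : K ^ 110 ≤ exp (M * δ / 8))
    (hτ1 : 1 ≤ τ) (hτT : τ ≤ T) (hT2 : T ≤ 2)
    (hρT : 64 * M * ρ ^ 4 * exp (4 * M * (T - τ)) ≤ ε ^ 2 * K ^ 20)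
    (hcτ : ∀ t, 0 ≤ t → t ≤ τ → X t 2 ≤ ρ ^ 2 / K ^ 10) (hcτeq : X τ 2 = ρ ^ 2 / K ^ 10)
    {t : ℝ} (ht : t ∈ Icc (τ + δ) T) : K ^ 100 * ρ ^ 2 ≤ X t 2 := by
  have hK0 : 0 < K := by linarith
  have ht' : t ∈ Icc τ T := ⟨by linarith [ht.1], ht.2⟩
  have hg := c_growth_on hX h0 hε hρ hρε hM0 hK hεK hMρ hKM hτ1 hτT hT2 hρT hcτ hcτeq ht'
  have hexp : M * δ / 8 ≤ M * (t - τ) / 8 := by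
    have h1 : δ ≤ t - τ := by linarith [ht.1]
    have h2 : M * δ ≤ M * (t - τ) := mul_le_mul_of_nonneg_left h1 hM0.le
    linarith
  calc K ^ 100 * ρ ^ 2 = ρ ^ 2 / K ^ 10 * K ^ 110 := by field_simp
    _ ≤ ρ ^ 2 / K ^ 10 * exp (M * δ / 8) := mul_le_mul_of_nonneg_left hon (by positivity)
    _ ≤ ρ ^ 2 / K ^ 10 * exp (M * (t - τ) / 8) :=
        mul_le_mul_of_nonneg_left (exp_le_exp.2 hexp) (by positivity)
    _ ≤ X t 2 := hg

/-- **(cgrow-2) on the horizon `T`**: on `I`, `0 ≤ ∂ₜc ≤ 6K¹⁰c`.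
[cite: Tao2016AveragedNS, §5.5 (cgrow-2)] -/
theorem c_deriv_bounds_on (hX : ∀ t, HasDerivAt X (rotorCircuit K M ε ρ (X t)) t)
    (h0 : X 0 = delayInit)
    (hε : 0 < ε) (hρ : 0 < ρ) (hρε : ρ ^ 2 ≤ ε) (hM0 : 0 < M) (hMK : M ≤ K ^ 10) (hK : 16 ≤ K)
    (hεK : ε ^ 2 ≤ 1 / (6 * K ^ 20)) (hMρ : M * ρ ^ 4 ≤ ε ^ 2) (hKM : exp (-M) ≤ 1 / K ^ 10)
    (hδ : 0 ≤ δ) (hon : K ^ 110 ≤ exp (M * δ / 8))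
    (hτ1 : 1 ≤ τ) (hτT : τ ≤ T) (hT2 : T ≤ 2)
    (hρT : 64 * M * ρ ^ 4 * exp (4 * M * (T - τ)) ≤ ε ^ 2 * K ^ 20)
    (hcτ : ∀ t, 0 ≤ t → t ≤ τ → X t 2 ≤ ρ ^ 2 / K ^ 10) (hcτeq : X τ 2 = ρ ^ 2 / K ^ 10)
    {t : ℝ} (ht : t ∈ Icc (τ + δ) T) :
    0 ≤ ρ ^ 2 * exp (-M) * X t 0 ^ 2 + ε⁻¹ * M * X t 1 * X t 2 ∧
      ρ ^ 2 * exp (-M) * X t 0 ^ 2 + ε⁻¹ * M * X t 1 * X t 2 ≤ 6 * K ^ 10 * X t 2 := by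
  have hK0 : 0 < K := by linarith
  have ht' : t ∈ Icc τ T := ⟨by linarith [ht.1], ht.2⟩
  have ht02 : t ∈ Icc (0 : ℝ) 2 := ⟨by linarith [ht'.1], ht.2.trans hT2⟩
  have hc0 : 0 ≤ X t 2 := c_nonneg hX h0 ht02.1
  have hcl : K ^ 100 * ρ ^ 2 ≤ X t 2 :=
    c_large_on hX h0 hε hρ hρε hM0 hK hεK hMρ hKM hδ hon hτ1 hτT hT2 hρT hcτ hcτeq ht
  have hb : ε / 8 ≤ X t 1 :=
    b_lower_on hX h0 hε hρ hρε hM0 hK hεK hMρ hKM hτ1 hτT hT2 hρT hcτ hcτeq ht'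
  have hb5 : |X t 1| ≤ 5 * ε := (bc_small hX h0 hε hρ hρε hM0.le ht02).1
  have ha : X t 0 ^ 2 ≤ 1 := traj_sq_le_one hX h0 t 0
  constructor
  · have h1 : 0 ≤ ε⁻¹ * M * X t 1 * X t 2 := by
      have : 0 ≤ X t 1 := by linarith [hε.le]
      have := hM0.le
      positivity
    have := hM0.le
    positivity
  · have hek : exp (-M) ≤ 1 := by rw [exp_le_one_iff, neg_nonpos]; exact hM0.le
    have h1 : ρ ^ 2 * exp (-M) * X t 0 ^ 2 ≤ K ^ 10 * X t 2 := by
      calc ρ ^ 2 * exp (-M) * X t 0 ^ 2 ≤ ρ ^ 2 * 1 * 1 :=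
            mul_le_mul (mul_le_mul_of_nonneg_left hek (by positivity)) ha (by positivity)
              (by positivity)
        _ ≤ K ^ 100 * ρ ^ 2 := by
            have : (1 : ℝ) ≤ K ^ 100 := one_le_pow₀ (by linarith)
            nlinarith [pow_pos hρ 2]
        _ ≤ X t 2 := hcl
        _ ≤ K ^ 10 * X t 2 := by
            have : (1 : ℝ) ≤ K ^ 10 := one_le_pow₀ (by linarith)
            nlinarith
    have h2 : ε⁻¹ * M * X t 1 * X t 2 ≤ 5 * K ^ 10 * X t 2 := by
      have hb' : X t 1 ≤ 5 * ε := (le_abs_self _).trans hb5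
      have h5 : ε⁻¹ * X t 1 ≤ 5 := by rw [inv_mul_le_iff₀ hε]; linarith
      have : ε⁻¹ * M * X t 1 * X t 2 = (ε⁻¹ * X t 1) * (M * X t 2) := by ring
      rw [this]
      have hkc : 0 ≤ M * X t 2 := mul_nonneg hM0.le hc0
      have hMc : M * X t 2 ≤ K ^ 10 * X t 2 := mul_le_mul_of_nonneg_right hMK hc0
      nlinarith
    linarith

end PulseFire

end Summit.NavierStokesRegularity.FluidComputer.RotorKnob
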